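import Mathlib.AlgebraicTopology.FundamentalGroupoid.FundamentalGroup
import Mathlib.GroupTheory.Index
import HarnessLib

/-!
# Book-keeping for `FundamentalGroup.mapOfEq`: composition, ranges and indices

Mathlib's `FundamentalGroup.mapOfEq f h : π₁(X, x) →* π₁(Y, y)` (for `h : f x = y`) is
`FundamentalGroup.map f x : π₁(X, x) →* π₁(Y, f x)` followed by the transport of the base point along
`h`. This file records the elementary compatibilities used when covering-space statements (phrased at
fixed base points, e.g. the unit of a topological group) are fed to the lifting criterion (phrased
with `FundamentalGroup.map`):

* `mapOfEq_rfl_apply`: `mapOfEq f rfl = map f x` (pointwise);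
* `mapOfEq_comp_apply`: `mapOfEq (g ∘ f) _ = mapOfEq g hg ∘ mapOfEq f hf`;
* `range_map_le_range_mapOfEq`: transfer of an inclusion of ranges
  `(mapOfEq Φ hy).range ≤ (mapOfEq p hp).range` (base point `y`, `p y = y`) to
  `(map Φ a).range ≤ (mapOfEq p _).range` (base point `Φ a`);
* `index_range_mapOfEq`: `[π₁(Y, y) : (mapOfEq f h)(π₁(X, x))] = [π₁(Y, f x) : (map f x)(π₁(X, x))]`.

Everything is proved (A. Hatcher, *Algebraic Topology*, §1.1, Prop. 1.5 and the remarks on base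
points, pp. 28, 37, for the underlying mathematics).
-/

noncomputable section

open CategoryTheory

universe u v w

namespace Literature.AlgebraicTopology.FundamentalGroup

variable {A : Type u} {X : Type v} {Y : Type w} [TopologicalSpace A] [TopologicalSpace X]
  [TopologicalSpace Y]

/-- `mapOfEq f rfl` is `map f x`. [folklore] -/
theorem mapOfEq_rfl_apply (f : C(X, Y)) (x : X) (γ : FundamentalGroup X x) :
    FundamentalGroup.mapOfEq f (rfl : f x = f x) γ = FundamentalGroup.map f x γ := by
  rw [FundamentalGroup.mapOfEq_apply, Path.Homotopic.Quotient.cast_rfl_rfl]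
  rfl

/-- **Functoriality of `mapOfEq`**: `mapOfEq (g ∘ f) = mapOfEq g hg ∘ mapOfEq f hf` (pointwise).
[folklore] -/
theorem mapOfEq_comp_apply (f : C(A, X)) (g : C(X, Y)) {a : A} {x : X} {y : Y} (hf : f a = x)
    (hg : g x = y) (γ : FundamentalGroup A a) :
    FundamentalGroup.mapOfEq (g.comp f) (show g.comp f a = y by rw [ContinuousMap.comp_apply, hf, hg]) γ =
      FundamentalGroup.mapOfEq g hg (FundamentalGroup.mapOfEq f hf γ) := by
  subst hf hg
  rw [mapOfEq_rfl_apply, mapOfEq_rfl_apply]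
  change FundamentalGroup.mapOfEq (g.comp f) (rfl : g.comp f a = g.comp f a) γ = _
  rw [mapOfEq_rfl_apply]
  induction γ using Quotient.inductionOn with | h ℓ =>
  exact Path.Homotopic.Quotient.map_comp (p := Path.Homotopic.Quotient.mk ℓ) (f := f) (g := g)

/-- `mapOfEq (g ∘ f)` as a composite of homomorphisms. [folklore] -/
theorem mapOfEq_comp_eq (f : C(A, X)) (g : C(X, Y)) {a : A} {x : X} {y : Y} (hf : f a = x)
    (hg : g x = y) :
    FundamentalGroup.mapOfEq (g.comp f) (show g.comp f a = y by rw [ContinuousMap.comp_apply, hf, hg]) =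
      (FundamentalGroup.mapOfEq g hg).comp (FundamentalGroup.mapOfEq f hf) :=
  MonoidHom.ext fun γ => mapOfEq_comp_apply f g hf hg γ

/-- **Transfer of an inclusion of ranges between base points**: if `(mapOfEq Φ hy)(π₁(A, a))` lies in
`(mapOfEq p hp)(π₁(X, y))` for a self-map `p` of `X` fixing `y = Φ a`, then `(map Φ a)(π₁(A, a))`
lies in `(mapOfEq p _)(π₁(X, y))`, the range at base point `Φ a` (the form of the hypothesis of the
lifting criterion, Mathlib `IsCoveringMap.existsUnique_continuousMap_lifts_of_range_le`). [folklore] -/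
theorem range_map_le_range_mapOfEq (Φ : C(A, X)) (p : C(X, X)) (a : A) {y : X} (hy : Φ a = y)
    (hp : p y = y)
    (h : (FundamentalGroup.mapOfEq Φ hy).range ≤ (FundamentalGroup.mapOfEq p hp).range) :
    (FundamentalGroup.map Φ a).range ≤
      (FundamentalGroup.mapOfEq p (show p y = Φ a by rw [hp, hy])).range := by
  subst hy
  rintro _ ⟨γ, rfl⟩
  obtain ⟨δ, hδ⟩ := h ⟨γ, rfl⟩
  refine ⟨δ, ?_⟩
  rw [hδ, mapOfEq_rfl_apply]

/-- Transporting the base point does not change the index of the image: the index of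
`(mapOfEq f h)(π₁(X, x))` in `π₁(Y, y)` is that of `(map f x)(π₁(X, x))` in `π₁(Y, f x)`. [folklore] -/
theorem index_range_mapOfEq (f : C(X, Y)) {x : X} {y : Y} (h : f x = y) :
    (FundamentalGroup.mapOfEq f h).range.index = (FundamentalGroup.map f x).range.index := by
  subst h
  congr 2
  exact MonoidHom.ext fun γ => mapOfEq_rfl_apply f x γ

end Literature.AlgebraicTopology.FundamentalGroup

end
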